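import Summits.CriticalPhenomena.PercolationContinuityZ3.Theorems.PercNearOneGluingNoHeavyLowerTailHullThreeIntegral
import Summits.CriticalPhenomena.PercolationContinuityZ3.Theorems.PercNearOneGluingNoHeavyLowerTailHullThreeSigns
import Summits.CriticalPhenomena.PercolationContinuityZ3.Theorems.PercNearOneGluingNoHeavyLowerTailCILTwoGates
import Literature.Probability.Percolation.LonelyClusterExchange
import HarnessLib

/-!
# `NoHeavyLowerTail` (stmt-CriticalPhenomena-4575) — CIL for every observer whose region has THREE hull ports (XZport₃)

Hull-port prover #4 (`prim-hp-4`, LP-duality technique), generation 2; `--supports stmt-CriticalPhenomena-4575`.  No definitions, no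
sorries, no named facts.  This file assembles the Lean proof of the paper theorem of memo `run/shared/lean/prim/prim-hp-4/HULLPORT-LP.md`
§9 from its layers: `…HullThreeCertificate` (per-world coefficient identity, kernel-decided), `…HullThreeWorld` (per-world positivity),
`…HullThreeJoin` (join lemma), `…HullThreeEvents` (hull decomposition), `…HullThreeIntegral` (integrated certificate `cert_nonneg`),
`…HullThreeSigns` (sign inputs Q1–Q3 on the inner law via BHK, the explicit multipliers).

Setting: `μ = prodBernoulli w` on `Fin n`, relays `A`, level `j`, `N = |π(o)|`, `M_x = |π(x)|`; a three-port hull `X : Hull3 n` (region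
`R ∋ o` avoiding `A`, distinct ports `p 0, p 1, p 2 ∈ A`, closure: a positive-weight pair at a region vertex ends in `R` or at a port —
e.g. `R` = the Steiner region of `o` and the ports = the relays adjacent to it).
* `Hull3.attached_le_best` (**XZport₃**): if `p 0` is a best port (`μ(M_{p i} ≤ j) ≤ μ(M_{p 0} ≤ j)`), then
  `μ(1 ≤ N ≤ j) ≤ μ(M_{p 0} ≤ j, 1 ≤ N)`.  Proof: the rows `Sh(0,k)` (`AttachedShift.attached_avoid_shift`) and `A[0;O]`
  (`observerSet_le_of_lonelier`) are nonnegative and `cert_nonneg` gives `θ·U ≥ Λ·Sh + Σ α·A ≥ 0` for three certificates: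
  I (generic inner law: polynomial multipliers, `θ > 0` by Q1–Q3 when the ports are pairwise separable, `attached_le_best_of_sep`),
  II (`o` never attached to a worse port alone: `θ = i0`), III (`p 0` glued to a worse port through weight-one inner pairs:
  `U = Sh(0,1) + Sh(0,2)`); the degenerate cases are detected on the weight-one configuration `F1`, whose pattern cell has positive
  probability (`prodBernoulli_real_localCylinder`) and whose inner connections hold almost surely.
* `Hull3.cil_threePort` (**CIL, three hull ports**): `∃ a ∈ A, μ(1 ≤ N ≤ j) ≤ μ(M_a ≤ j)` for EVERY three-port hull (no best-port,
  separation or weight hypothesis; the ports are relabelled, `Hull3.perm`) — the registered stub `stub_cumulativeIsolation` of the crux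
  on this class.  With `cil_of_twoGates` (≤ 2 gates) this settles CIL for every observer with at most three hull ports.
[cite: VandenbergHaggstromKahn2005, Thm. 1.5 — the only probabilistic input beyond independence and the polynomial identity]
-/

noncomputable section

namespace Summit.CriticalPhenomena.PercolationContinuityZ3.Theorems

open MeasureTheory Set Literature.Probability.LatticeModels Literature.Probability.Percolation
open scoped Classical BigOperators

variable {n : ℕ}

namespace HullThree

namespace Hull3

variable {X : Hull3 n} {A : Finset (Fin n)} {j : ℕ}

/-- The shift rows are nonnegative when `p 0` is a best port. -/
theorem Sh_nonneg (k : Fin 3)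
    (hbest : (prodBernoulli X.w).real {ω : BondConfig (Fin n) | (A.filter fun x => ω ∈ openConn (X.p k) x).card ≤ j} ≤
      (prodBernoulli X.w).real {ω : BondConfig (Fin n) | (A.filter fun x => ω ∈ openConn (X.p 0) x).card ≤ j}) :
    0 ≤ (prodBernoulli X.w).real ((openConn X.o (X.p k) : Set (BondConfig (Fin n))) ∩ (openConn X.o (X.p 0))ᶜ ∩
          {ω | Mcnt X A ω ≤ j}) -
        (prodBernoulli X.w).real ((openConn X.o (X.p k) : Set (BondConfig (Fin n))) ∩ (openConn X.o (X.p 0))ᶜ ∩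
          {ω | Ncnt X A ω ≤ j}) :=
  sub_nonneg.2 (AttachedShift.attached_avoid_shift X.w A X.o (X.p k) (X.p 0) j hbest)

/-- The observer-set rows are nonnegative when `O` contains a port no better than `p 0`. -/
theorem A_nonneg (O : Finset (Fin n)) (k : Fin 3) (hk : X.p k ∈ O)
    (hbest : (prodBernoulli X.w).real {ω : BondConfig (Fin n) | (A.filter fun x => ω ∈ openConn (X.p k) x).card ≤ j} ≤
      (prodBernoulli X.w).real {ω : BondConfig (Fin n) | (A.filter fun x => ω ∈ openConn (X.p 0) x).card ≤ j}) :
    0 ≤ (prodBernoulli X.w).real {ω | (∀ x ∈ O, ω ∉ openConn (X.p 0) x) ∧ Mcnt X A ω ≤ j} -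
        (prodBernoulli X.w).real {ω | (∀ x ∈ O, ω ∉ openConn (X.p 0) x) ∧ 1 ≤ Scnt A O ω ∧ Scnt A O ω ≤ j} := by
  have h := observerSet_le_of_lonelier X.w A O (X.p k) (X.p 0) hk j hbest
  rw [sub_nonneg]
  convert h using 7
  all_goals exact congrArg Finset.card (@Finset.filter_congr _ _ _ (_) (_) _ fun _ _ => Iff.rfl)

/-- Arithmetic of certificate I (generic inner law): the explicit multipliers are nonnegative, `θ > 0`, and the integrated
certificate forces `U ≥ 0`. -/
theorem arith_certI (s1 s2 i1 i2 i0 d a1 a2 a12 g12 g01 g02 a1p a2p θ Λ α1 α2 α12 κ1 κ2 U Sh A1 A2 A12 : ℝ)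
    (hs1 : 0 ≤ s1) (hs2 : 0 ≤ s2) (hi1 : 0 ≤ i1) (hi2 : 0 ≤ i2) (hi0 : 0 ≤ i0) (hd : 0 < d)
    (hg12 : 0 ≤ g12) (hg01 : 0 ≤ g01) (hg02 : 0 ≤ g02)
    (hI1 : i1 = d + g02) (hI2 : i2 = d + g01) (hI0 : i0 = d + g12) (hS1 : s1 = a1 + a1p) (hS2 : s2 = a2 + a2p)
    (Q1 : (a1 + a2 + a12) * g12 ≤ i0 * a12) (Q2 : a2p * i2 ≤ s2 * g01) (Q3 : a1p * i1 ≤ s1 * g02) (hA : 0 < a1 + a2)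
    (eθ : θ = Λ + (a1 + a2) * i1 * i2 * i0)
    (eΛ : Λ = ((a1 * g02 - d * a1p) * i2 + (a2 * g01 - d * a2p) * i1) * i0)
    (eα1 : α1 = (a1 + a2) * s1 * i2 * i0) (eα2 : α2 = (a1 + a2) * s2 * i1 * i0)
    (eα12 : α12 = (s1 * i2 + s2 * i1) * (d * a12 - (a1 + a2) * g12))
    (eκ1 : κ1 = (a1 + a2) * i1 * i0 * (s2 * g01 - a2p * i2)) (eκ2 : κ2 = (a1 + a2) * i2 * i0 * (s1 * g02 - a1p * i1))
    (hSh : 0 ≤ Sh) (hA1 : 0 ≤ A1) (hA2 : 0 ≤ A2) (hA12 : 0 ≤ A12)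
    (cert : 0 ≤ κ1 → 0 ≤ κ2 → 0 ≤ θ * U - Λ * Sh - α1 * A1 - α2 * A2 - α12 * A12) : 0 ≤ U := by
  have q3' : a1p * d ≤ a1 * g02 := by rw [hI1, hS1] at Q3; linarith
  have q2' : a2p * d ≤ a2 * g01 := by rw [hI2, hS2] at Q2; linarith
  have q1' : (a1 + a2) * g12 ≤ d * a12 := by rw [hI0] at Q1; linarith
  have hA' : 0 ≤ a1 + a2 := hA.le
  have hk1 : 0 ≤ κ1 := by
    rw [eκ1]; exact mul_nonneg (mul_nonneg (mul_nonneg hA' hi1) hi0) (by linarith)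
  have hk2 : 0 ≤ κ2 := by
    rw [eκ2]; exact mul_nonneg (mul_nonneg (mul_nonneg hA' hi2) hi0) (by linarith)
  have h := cert hk1 hk2
  have hΛ : 0 ≤ Λ := by
    rw [eΛ]
    refine mul_nonneg (add_nonneg (mul_nonneg ?_ hi2) (mul_nonneg ?_ hi1)) hi0 <;> linarith
  have hθ : 0 < θ := by
    rw [eθ]
    have hi1' : 0 < i1 := by rw [hI1]; linarith
    have hi2' : 0 < i2 := by rw [hI2]; linarith
    have hi0' : 0 < i0 := by rw [hI0]; linarith
    have : 0 < (a1 + a2) * i1 * i2 * i0 := mul_pos (mul_pos (mul_pos hA hi1') hi2') hi0'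
    linarith
  have hα1 : 0 ≤ α1 := by rw [eα1]; exact mul_nonneg (mul_nonneg (mul_nonneg hA' hs1) hi2) hi0
  have hα2 : 0 ≤ α2 := by rw [eα2]; exact mul_nonneg (mul_nonneg (mul_nonneg hA' hs2) hi1) hi0
  have hα12 : 0 ≤ α12 := by
    rw [eα12]; exact mul_nonneg (add_nonneg (mul_nonneg hs1 hi2) (mul_nonneg hs2 hi1)) (by linarith)
  have h1 := mul_nonneg hΛ hSh
  have h2 := mul_nonneg hα1 hA1
  have h3 := mul_nonneg hα2 hA2
  have h4 := mul_nonneg hα12 hA12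
  have hmain : 0 ≤ θ * U := by linarith
  exact (mul_nonneg_iff_of_pos_left hθ).1 hmain

/-- Arithmetic of certificate II (`o` never attached to a worse port alone). -/
theorem arith_certII (s1 s2 i1 i2 i0 d a1 a2 a12 g12 g01 g02 a1p a2p U A12 : ℝ)
    (hd : 0 < d) (ha1 : 0 ≤ a1) (ha2 : 0 ≤ a2) (ha12 : 0 ≤ a12) (ha1p : 0 ≤ a1p) (ha2p : 0 ≤ a2p)
    (hI1 : i1 = d + g02) (hI2 : i2 = d + g01) (hI0 : i0 = d + g12) (hS1 : s1 = a1 + a1p) (hS2 : s2 = a2 + a2p)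
    (hg12 : 0 ≤ g12) (Q2 : a2p * i2 ≤ s2 * g01) (Q3 : a1p * i1 ≤ s1 * g02) (hA : a1 + a2 = 0) (hA12 : 0 ≤ A12)
    (cert : s1 = 0 → s2 = 0 → a1 = 0 → a2 = 0 → a1p = 0 → a2p = 0 → 0 ≤ i0 * U - a12 * A12) : 0 ≤ U := by
  have ea1 : a1 = 0 := by linarith
  have ea2 : a2 = 0 := by linarith
  have q3' : a1p * d ≤ a1 * g02 := by rw [hI1, hS1] at Q3; linarith
  have q2' : a2p * d ≤ a2 * g01 := by rw [hI2, hS2] at Q2; linarith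
  have ea1p : a1p = 0 := by
    by_contra hne
    have : 0 < a1p * d := mul_pos (lt_of_le_of_ne ha1p (Ne.symm hne)) hd
    rw [ea1, zero_mul] at q3'
    linarith
  have ea2p : a2p = 0 := by
    by_contra hne
    have : 0 < a2p * d := mul_pos (lt_of_le_of_ne ha2p (Ne.symm hne)) hd
    rw [ea2, zero_mul] at q2'
    linarith
  have es1 : s1 = 0 := by rw [hS1, ea1, ea1p, add_zero]
  have es2 : s2 = 0 := by rw [hS2, ea2, ea2p, add_zero]
  have h := cert es1 es2 ea1 ea2 ea1p ea2p
  have h4 := mul_nonneg ha12 hA12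
  have hi0' : 0 < i0 := by rw [hI0]; linarith
  have hmain : 0 ≤ i0 * U := by linarith
  exact (mul_nonneg_iff_of_pos_left hi0').1 hmain

/-- **XZport₃, separated case.**  If `p 0` is a best port and the ports are pairwise inner-separated with positive probability, then
`μ(1 ≤ N ≤ j) ≤ μ(M_{p 0} ≤ j, 1 ≤ N)` (certificates I / II). -/
theorem attached_le_best_of_sep (hA : ∀ a ∈ A, a ∉ X.R) (hpA : ∀ i, X.p i ∈ A)
    (hbest : ∀ i : Fin 3,
      (prodBernoulli X.w).real {ω : BondConfig (Fin n) | (A.filter fun x => ω ∈ openConn (X.p i) x).card ≤ j} ≤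
        (prodBernoulli X.w).real {ω : BondConfig (Fin n) | (A.filter fun x => ω ∈ openConn (X.p 0) x).card ≤ j})
    (hd : 0 < (prodBernoulli X.w).real (sepEv X)) :
    (prodBernoulli X.w).real {ω : BondConfig (Fin n) | 1 ≤ Ncnt X A ω ∧ Ncnt X A ω ≤ j} ≤
      (prodBernoulli X.w).real {ω : BondConfig (Fin n) | Mcnt X A ω ≤ j ∧ 1 ≤ Ncnt X A ω} := by
  -- the rows
  have hSh1 := Sh_nonneg (A := A) (j := j) 1 (hbest 1)
  have hSh2 := Sh_nonneg (A := A) (j := j) 2 (hbest 2)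
  have hA1 := A_nonneg (A := A) (j := j) {X.p 1} 1 (Finset.mem_singleton_self _) (hbest 1)
  have hA2 := A_nonneg (A := A) (j := j) {X.p 2} 2 (Finset.mem_singleton_self _) (hbest 2)
  have hA12 := A_nonneg (A := A) (j := j) {X.p 1, X.p 2} 1 (by simp) (hbest 1)
  have hd' : 0 < cst pD X.xlaw := by rwa [cst_pD_eq]
  rw [← sub_nonneg]
  by_cases hAz : cst pA1 X.xlaw + cst pA2 X.xlaw = 0
  · -- certificate II
    refine arith_certII (cst pS1 X.xlaw) (cst pS2 X.xlaw) (cst pI1 X.xlaw) (cst pI2 X.xlaw) (cst pI0 X.xlaw) (cst pD X.xlaw)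
      (cst pA1 X.xlaw) (cst pA2 X.xlaw) (cst pA12 X.xlaw) (cst pG12 X.xlaw) (cst pG01 X.xlaw) (cst pG02 X.xlaw)
      (cst pA1p X.xlaw) (cst pA2p X.xlaw) _ _ hd' (cst_nonneg _) (cst_nonneg _) (cst_nonneg _) (cst_nonneg _)
      (cst_nonneg _) (cst_split iota_pI1 _) (cst_split iota_pI2 _) (cst_split iota_pI0 _) (cst_split iota_pS1 _)
      (cst_split iota_pS2 _) (cst_nonneg _) (inner_Q2 X) (inner_Q3 X) hAz hA12 fun es1 es2 ea1 ea2 ea1p ea2p => ?_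
    have h := cert_nonneg (X := X) (A := A) (j := j) hA hpA (cst pI0 X.xlaw) 0 0 0 (cst pA12 X.xlaw)
      (by simp only [E1]; rw [ea1, ea2]; ring) (by simp only [E2]; rw [es1]; ring) (by simp only [E3]; rw [es2]; ring)
      (by simp only [E4]; ring) (by simp only [k01]; rw [ea2p]; simp) (by simp only [k02]; rw [ea1p]; simp)
    linarith
  · -- certificate I
    have hApos : 0 < cst pA1 X.xlaw + cst pA2 X.xlaw := lt_of_le_of_ne (add_nonneg (cst_nonneg _) (cst_nonneg _)) (Ne.symm hAz)
    refine arith_certI (cst pS1 X.xlaw) (cst pS2 X.xlaw) (cst pI1 X.xlaw) (cst pI2 X.xlaw) (cst pI0 X.xlaw) (cst pD X.xlaw)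
      (cst pA1 X.xlaw) (cst pA2 X.xlaw) (cst pA12 X.xlaw) (cst pG12 X.xlaw) (cst pG01 X.xlaw) (cst pG02 X.xlaw)
      (cst pA1p X.xlaw) (cst pA2p X.xlaw) (θI X.xlaw) (ΛI X.xlaw) (α1I X.xlaw) (α2I X.xlaw) (α12I X.xlaw)
      (k01 X.xlaw (θI X.xlaw) (ΛI X.xlaw) (α2I X.xlaw)) (k02 X.xlaw (θI X.xlaw) (ΛI X.xlaw) (α1I X.xlaw)) _ _ _ _ _
      (cst_nonneg _) (cst_nonneg _) (cst_nonneg _) (cst_nonneg _) (cst_nonneg _) hd'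
      (cst_nonneg _) (cst_nonneg _) (cst_nonneg _)
      (cst_split iota_pI1 _) (cst_split iota_pI2 _) (cst_split iota_pI0 _) (cst_split iota_pS1 _) (cst_split iota_pS2 _)
      (inner_Q1 X) (inner_Q2 X) (inner_Q3 X) hApos (certI_θ _) (certI_Λ _) rfl rfl rfl (certI_k01 _) (certI_k02 _)
      (add_nonneg hSh1 hSh2) hA1 hA2 hA12 fun hk1 hk2 => ?_
    have h := cert_nonneg (X := X) (A := A) (j := j) hA hpA (θI X.xlaw) (ΛI X.xlaw) (α1I X.xlaw) (α2I X.xlaw)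
      (α12I X.xlaw) (certI_E1 X.xlaw) (certI_E2 X.xlaw) (certI_E3 X.xlaw) (certI_E4 X.xlaw) hk1 hk2
    linarith

/-! ### The degenerate case: two ports glued through the region almost surely -/

/-- The inner pairs of weight one. -/
def F1 (X : Hull3 n) : Set (Sym2 (Fin n)) := {e | e ∈ X.F ∧ X.w e = 1}

/-- Almost surely every weight-one inner pair is open. -/
theorem real_not_superset_F1 : (prodBernoulli X.w).real {ω : BondConfig (Fin n) | ¬ F1 X ⊆ ω} = 0 := by
  have hsub : {ω : BondConfig (Fin n) | ¬ F1 X ⊆ ω} ⊆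
      ⋃ e ∈ X.F.filter (fun e => X.w e = 1), {ω : BondConfig (Fin n) | e ∉ ω} := by
    intro ω hω
    simp only [mem_setOf_eq, not_subset] at hω
    obtain ⟨e, ⟨heF, hwe⟩, heω⟩ := hω
    exact mem_biUnion (Finset.mem_filter.2 ⟨heF, hwe⟩) heω
  refine le_antisymm ((measureReal_mono hsub (measure_ne_top _ _)).trans ?_) measureReal_nonneg
  refine (measureReal_biUnion_finset_le _ _).trans (le_of_eq (Finset.sum_eq_zero fun e he => ?_))
  rw [CutObserver.measureReal_closed, (Finset.mem_filter.1 he).2]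
  simp

/-- A pattern cell whose bits contradict a connection forced by the weight-one inner pairs is null. -/
theorem xlaw_eq_zero_of_forced (b : IB) {u v : Fin n} (huv : (X.Gin (F1 X)).Reachable u v)
    (hb : ∀ ω : BondConfig (Fin n), X.ibits ω = b → ¬ (X.Gin ω).Reachable u v) : X.xlaw b = 0 := by
  have hsub : X.cell b ⊆ {ω : BondConfig (Fin n) | ¬ F1 X ⊆ ω} := by
    intro ω hω hF
    refine hb ω hω (huv.mono (openGraph_mono ?_))
    exact inter_subset_inter_left _ hF
  exact le_antisymm ((measureReal_mono hsub (measure_ne_top _ _)).trans (le_of_eq real_not_superset_F1))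
    measureReal_nonneg

/-- The pattern of the weight-one configuration has positive probability (its cylinder has). -/
theorem xlaw_ibits_F1_pos : 0 < X.xlaw (X.ibits (F1 X)) := by
  have hsub : localCylinder (↑X.F : Set (Sym2 (Fin n))) (F1 X) ⊆ X.cell (X.ibits (F1 X)) := by
    intro ω hω
    refine ibits_congr (X := X) ?_
    ext e
    simp only [mem_inter_iff, Finset.mem_coe]
    constructor
    · rintro ⟨he, heF⟩; exact ⟨(hω e heF).1 he, heF⟩
    · rintro ⟨he, heF⟩; exact ⟨(hω e heF).2 he, heF⟩
  refine lt_of_lt_of_le ?_ (measureReal_mono hsub (measure_ne_top _ _))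
  rw [prodBernoulli_real_localCylinder]
  refine Finset.prod_pos fun e he => ?_
  by_cases h1 : e ∈ F1 X
  · rw [if_pos h1, h1.2]; norm_num
  · rw [if_neg h1]
    have hne : X.w e ≠ 1 := fun h => h1 ⟨he, h⟩
    have hle : (X.w e : ℝ) ≤ 1 := (X.w e).2.2
    have hne' : (X.w e : ℝ) ≠ 1 := fun h => hne (Subtype.ext h)
    have := lt_of_le_of_ne hle hne'
    linarith

/-- A constant vanishes if every pattern carrying it is null. -/
theorem cst_eq_zero_of (P : IB → Bool) (h : ∀ b : IB, P b = true → X.xlaw b = 0) : cst P X.xlaw = 0 :=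
  Finset.sum_eq_zero fun b _ => by
    by_cases hb : P b = true
    · rw [if_pos hb, h b hb]
    · rw [if_neg hb]

/-- A constant dominates the law of any pattern carrying it. -/
theorem xlaw_le_cst (P : IB → Bool) (b : IB) (hb : P b = true) : X.xlaw b ≤ cst P X.xlaw := by
  unfold cst
  have := Finset.single_le_sum (f := fun b' => if P b' = true then X.xlaw b' else 0)
    (fun b' _ => by split_ifs; exacts [xlaw_nonneg b', le_rfl]) (Finset.mem_univ b)
  simpa [hb] using this

/-- Bit bookkeeping for the degenerate case (kernel decision on closed patterns). -/
theorem bits_degenerate : ∀ b : IB, b.closed = true →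
    ((pS1 b = true ∨ pS2 b = true ∨ pA1 b = true ∨ pA2 b = true ∨ pA1p b = true ∨ pA2p b = true) → b.p12 = false) ∧
    ((pA1 b = true ∨ pA2 b = true ∨ pA12 b = true) → b.p01 = false ∧ b.p02 = false) ∧
    (pA12 b = true → pI0 b = true) := by
  decide +kernel

/-- **XZport₃ (attached form of CIL for a three-port hull).**  If `p 0` is a best port, then `μ(1 ≤ N ≤ j) ≤ μ(M_{p 0} ≤ j, 1 ≤ N)`.
The ports need not be separable: if two of them are glued through weight-one inner pairs, certificate II (`{p 1, p 2}` glued) or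
certificate III = `U = Sh(0,1) + Sh(0,2)` (`p 0` glued to a worse port) applies. -/
theorem attached_le_best (hA : ∀ a ∈ A, a ∉ X.R) (hpA : ∀ i, X.p i ∈ A)
    (hbest : ∀ i : Fin 3,
      (prodBernoulli X.w).real {ω : BondConfig (Fin n) | (A.filter fun x => ω ∈ openConn (X.p i) x).card ≤ j} ≤
        (prodBernoulli X.w).real {ω : BondConfig (Fin n) | (A.filter fun x => ω ∈ openConn (X.p 0) x).card ≤ j}) :
    (prodBernoulli X.w).real {ω : BondConfig (Fin n) | 1 ≤ Ncnt X A ω ∧ Ncnt X A ω ≤ j} ≤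
      (prodBernoulli X.w).real {ω : BondConfig (Fin n) | Mcnt X A ω ≤ j ∧ 1 ≤ Ncnt X A ω} := by
  set b₁ := X.ibits (F1 X) with hb₁
  have hcl : b₁.closed = true := closed_ibits _
  -- rows and certificate III
  have hSh1 := Sh_nonneg (A := A) (j := j) 1 (hbest 1)
  have hSh2 := Sh_nonneg (A := A) (j := j) 2 (hbest 2)
  have hA12 := A_nonneg (A := A) (j := j) {X.p 1, X.p 2} 1 (by simp) (hbest 1)
  have certIII : cst pA1 X.xlaw = 0 → cst pA2 X.xlaw = 0 → cst pA12 X.xlaw = 0 →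
      (prodBernoulli X.w).real {ω : BondConfig (Fin n) | 1 ≤ Ncnt X A ω ∧ Ncnt X A ω ≤ j} ≤
        (prodBernoulli X.w).real {ω : BondConfig (Fin n) | Mcnt X A ω ≤ j ∧ 1 ≤ Ncnt X A ω} := by
    intro e1 e2 e12
    have h := cert_nonneg (X := X) (A := A) (j := j) hA hpA 1 1 0 0 0
      (by simp only [E1]; rw [e1, e2, e12]; ring) (by simp only [E2]; ring) (by simp only [E3]; ring)
      (by simp only [E4]; rw [e12]; ring) (by simp only [k01]; simp) (by simp only [k02]; simp)
    linarith
  by_cases h12 : b₁.p12 = true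
  · -- ports 1, 2 glued: every pattern with `p12 = false` is null
    have hz : ∀ b : IB, b.p12 = false → X.xlaw b = 0 := fun b hb =>
      xlaw_eq_zero_of_forced b ((p12_iff (F1 X)).2 h12) fun ω hω hr => by
        have := (p12_iff ω).1 hr; rw [hω, hb] at this; exact Bool.false_ne_true this
    have z : ∀ P : IB → Bool, (∀ b : IB, b.closed = true → P b = true → b.p12 = false) → cst P X.xlaw = 0 :=
      fun P hP => cst_eq_zero_of P fun b hb => by
        by_cases hc : b.closed = true
        · exact hz b (hP b hc hb)
        · exact xlaw_eq_zero_of_not_closed b (by simpa using hc)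
    have es1 := z pS1 fun b hc hb => (bits_degenerate b hc).1 (Or.inl hb)
    have es2 := z pS2 fun b hc hb => (bits_degenerate b hc).1 (Or.inr (Or.inl hb))
    have ea1 := z pA1 fun b hc hb => (bits_degenerate b hc).1 (Or.inr (Or.inr (Or.inl hb)))
    have ea2 := z pA2 fun b hc hb => (bits_degenerate b hc).1 (Or.inr (Or.inr (Or.inr (Or.inl hb))))
    have ea1p := z pA1p fun b hc hb => (bits_degenerate b hc).1 (Or.inr (Or.inr (Or.inr (Or.inr (Or.inl hb)))))
    have ea2p := z pA2p fun b hc hb => (bits_degenerate b hc).1 (Or.inr (Or.inr (Or.inr (Or.inr (Or.inr hb)))))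
    by_cases h0 : cst pA12 X.xlaw = 0
    · exact certIII ea1 ea2 h0
    · -- certificate II with `θ = i0 ≥ a12 > 0`
      have ha12 : 0 < cst pA12 X.xlaw := lt_of_le_of_ne (cst_nonneg _) (Ne.symm h0)
      have hi0 : cst pA12 X.xlaw ≤ cst pI0 X.xlaw := by
        refine Finset.sum_le_sum fun b _ => ?_
        by_cases hb : pA12 b = true
        · by_cases hc : b.closed = true
          · rw [if_pos hb, if_pos ((bits_degenerate b hc).2.2 hb)]
          · rw [xlaw_eq_zero_of_not_closed b (by simpa using hc)]; split_ifs <;> simp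
        · rw [if_neg hb]; split_ifs; exacts [xlaw_nonneg b, le_rfl]
      have h := cert_nonneg (X := X) (A := A) (j := j) hA hpA (cst pI0 X.xlaw) 0 0 0 (cst pA12 X.xlaw)
        (by simp only [E1]; rw [ea1, ea2]; ring) (by simp only [E2]; rw [es1]; ring) (by simp only [E3]; rw [es2]; ring)
        (by simp only [E4]; ring) (by simp only [k01]; rw [ea2p]; simp) (by simp only [k02]; rw [ea1p]; simp)
      have h4 := mul_nonneg (cst_nonneg (X := X) pA12) hA12
      rw [← sub_nonneg]
      refine (mul_nonneg_iff_of_pos_left (lt_of_lt_of_le ha12 hi0)).1 ?_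
      linarith
  · by_cases h0x : b₁.p01 = true ∨ b₁.p02 = true
    · -- port 0 glued to a worse port: certificate III
      have hz : ∀ b : IB, b.p01 = false ∧ b.p02 = false → X.xlaw b = 0 := by
        intro b hb
        rcases h0x with h01 | h02
        · exact xlaw_eq_zero_of_forced b ((p01_iff (F1 X)).2 h01) fun ω hω hr => by
            have := (p01_iff ω).1 hr; rw [hω, hb.1] at this; exact Bool.false_ne_true this
        · exact xlaw_eq_zero_of_forced b ((p02_iff (F1 X)).2 h02) fun ω hω hr => by
            have := (p02_iff ω).1 hr; rw [hω, hb.2] at this; exact Bool.false_ne_true this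
      have z : ∀ P : IB → Bool, (∀ b : IB, b.closed = true → P b = true → b.p01 = false ∧ b.p02 = false) →
          cst P X.xlaw = 0 :=
        fun P hP => cst_eq_zero_of P fun b hb => by
          by_cases hc : b.closed = true
          · exact hz b (hP b hc hb)
          · exact xlaw_eq_zero_of_not_closed b (by simpa using hc)
      exact certIII (z pA1 fun b hc hb => (bits_degenerate b hc).2.1 (Or.inl hb))
        (z pA2 fun b hc hb => (bits_degenerate b hc).2.1 (Or.inr (Or.inl hb)))
        (z pA12 fun b hc hb => (bits_degenerate b hc).2.1 (Or.inr (Or.inr hb)))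
    · -- the weight-one pairs separate the ports: `d > 0`, the separated case applies
      simp only [not_or, Bool.not_eq_true] at h0x
      have hD : pD b₁ = true :=
        (bits_table b₁ hcl).2.2.2.2.2.2.2.2.2.2.2.2.2 ⟨h0x.1, h0x.2, by simpa using h12⟩
      have hd : 0 < (prodBernoulli X.w).real (sepEv X) := by
        rw [← cst_pD_eq]
        exact lt_of_lt_of_le xlaw_ibits_F1_pos (xlaw_le_cst pD b₁ hD)
      exact attached_le_best_of_sep hA hpA hbest hd

/-- The separation event is invariant under relabelling the ports. -/
theorem sepEv_perm (σ : Equiv.Perm (Fin 3)) : sepEv (X.perm σ) = sepEv X := by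
  ext ω
  simp only [sepEv, mem_setOf_eq]
  constructor
  · intro h i k hik
    have := h (σ.symm i) (σ.symm k) (fun e => hik (σ.symm.injective e))
    simpa [perm, Gin, F] using this
  · intro h i k hik
    have := h (σ i) (σ k) (fun e => hik (σ.injective e))
    simpa [perm, Gin, F] using this

/-- **CIL for every three-port hull** (the registered stub `stub_cumulativeIsolation` of crux `NoHeavyLowerTail` on this class):
if the relays avoid the region and the three ports are relays, then some relay `a` has `μ(1 ≤ N ≤ j) ≤ μ(M_a ≤ j)` — namely the port
that is most often light.  No separation or weight hypothesis. -/
theorem cil_threePort (X : Hull3 n) (A : Finset (Fin n)) (j : ℕ) (hA : ∀ a ∈ A, a ∉ X.R) (hpA : ∀ i, X.p i ∈ A) :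
    ∃ a ∈ A,
      (prodBernoulli X.w).real {ω : BondConfig (Fin n) |
          1 ≤ (A.filter fun x => ω ∈ openConn X.o x).card ∧ (A.filter fun x => ω ∈ openConn X.o x).card ≤ j} ≤
        (prodBernoulli X.w).real {ω : BondConfig (Fin n) | (A.filter fun x => ω ∈ openConn a x).card ≤ j} := by
  -- pick a best port
  set f : Fin 3 → ℝ := fun i =>
    (prodBernoulli X.w).real {ω : BondConfig (Fin n) | (A.filter fun x => ω ∈ openConn (X.p i) x).card ≤ j} with hf
  obtain ⟨i₀, -, hi₀⟩ := Finset.exists_max_image Finset.univ f Finset.univ_nonempty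
  -- relabel so that the best port is `p 0`
  let σ : Equiv.Perm (Fin 3) := Equiv.swap 0 i₀
  let Y : Hull3 n := X.perm σ
  have hY0 : Y.p 0 = X.p i₀ := by simp [Y, perm, σ]
  have hbest : ∀ i : Fin 3,
      (prodBernoulli Y.w).real {ω : BondConfig (Fin n) | (A.filter fun x => ω ∈ openConn (Y.p i) x).card ≤ j} ≤
        (prodBernoulli Y.w).real {ω : BondConfig (Fin n) | (A.filter fun x => ω ∈ openConn (Y.p 0) x).card ≤ j} := by
    intro i
    rw [hY0]
    exact hi₀ (σ i) (Finset.mem_univ _)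
  have key := attached_le_best (X := Y) (A := A) (j := j) hA (fun i => hpA (σ i)) hbest
  refine ⟨X.p i₀, hpA i₀, ?_⟩
  rw [← hY0]
  exact key.trans (measureReal_mono (fun ω hω => hω.1) (measure_ne_top _ _))

end Hull3

end HullThree

end Summit.CriticalPhenomena.PercolationContinuityZ3.Theorems

end
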